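import Literature.MathematicalPhysics.QuantumFieldTheory.Balaban1983to89.Node00.TorusCoverLandau153RecTowerDoorGrad

/-!
# NODE 00 — THE R7 DOOR, STAGES 1–2, **PRE-COMPOSED EDITION**: `exists_suGauge_letters152_recTower_member_grad` (g12) and `exists_localGauge152_recTower_window_member_grad` (g12)
# VERBATIM with the TWO pass-through conjuncts `Restr129Z L k Λ′ 1 u` and the (1.137) row `logCovIterZ … = mlog (avgIterZ (c.axial V) …)` DELETED from the input `hG` and from the exported tuple

Cell `pub-ymgap`, width seat `pub-ymgap-dag-n07-w3` g13 (junction side of the K0 road; (W2) door re-cut (P-a), located by dag-n07-e g32 ⚑ LOCATED-W2-DOOR, bus 2026-08-30 02:23Z).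
`--kind proof --supports stmt-QuantumFields-20541` (K0⁷; count-neutral; THEOREMS ONLY, 0 `def`).  [6] = [Balaban1985RegularSpaces]; [15] = [Balaban1985Variational]; [I] = [Balaban1987RG1].
CONSUMED BY NAME, nothing modified: g10's `Node00.TorusCoverLandau153RecTower` (`exists_suGauge_of_specialUnitaryGauge_local`, `sideTouches_of_mem_fam`, `CubeB8DZ.mem_sq_zero_iff_inBox ∕
cube_top_subset_sq_pred ∕ sq_zero_subset_tcube`), `Node00.TorusCoverLandau153RecTowerDoor` (`cover_shift_add_e ∕ _sub_e`, `codiffCurlA_coverShift_eq_pdiv_of_window`,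
`lap_coverShift_eq_covLap_of_window`, `cfgExp_eq_expI`), `Node00.TorusCoverPropSixGaugeLevels.norm_logCfg_sub_le_of_msup_grad_at`, g11's `B8Eq191FlatLettersDentedCubeMemberRec.sq_antitone`.

WHY.  The three generic R7 doors of this lineage (STAGE 1 ✓`…RecTowerGrad`, STAGE 2 ✓`…RecTowerDoorGrad`, STAGE 3 ✓`…RecDatumDoorGrad` §1) take ONE gauge function `u` in
`hG := ∃ u, SU ∧ (u = 1 off Ω′₀) ∧ Restr129Z … u ∧ IsLandau138WZ … (fixed V u) ∧ rows(fixed V u, expo η V u, (vfix V)⁻¹·u, …)` and RE-EXPORT `Restr129Z … u` (and likewise the (1.137) row `logCovIterZ … = mlog (avgIterZ (c.axial V) …)`) without ever reading them in a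
proof step (they served the OLD rows 9 ∕ 9′).  The junction's φ-road feeds the doors with the PRE-COMPOSED crown's gauge function `u := h⁻¹·u₀` (`h` block-constant on the cell towers, dag-n05-e
✓`B8BlockConstantLiftDentedRec`; this seat's ✓p751907 `DatumCrownPhiAt` delivers `Restr129Z … u₀` and the rows at `h⁻¹·u₀`), for which `Restr129Z … (h⁻¹·u₀)` is FALSE whenever `h ≠ 1`
(`R̄ʲ(h⁻¹u₀)(y) = X(j,y)⁻¹`, ✓p752835) and whose (1.137) row reads `… = mlog (avgIterZ (gaugeAct h (c.axial V)) …)` (pre-composed), not the doors' shape.  THIS FILE is the token-deletion twin: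
statements and proofs byte-identical to g12's except that the two conjuncts are absent from `hG`, from the output, from one `obtain` pattern and one anonymous-constructor entry per stage
(located by dag-n07-e g32, bus 02:23Z ∕ 02:50Z).  The new row 9′ (`NrmSymPhiOfRecord … (Ψ ε j)`) is supplied by the junction from `u₀` and `h` directly.

WHAT IS PROVED (sorry-free).  ★★ `exists_suGauge_letters152_recTower_member_grad_precomp` (STAGE 1, generic `CubeB8DZ d L K Ω`, generic `SU(N)`-valued `ℤᵈ` field `V`) and
★★ `exists_localGauge152_recTower_window_member_grad_precomp` (STAGE 2, the window push-down through a translated cover) — g12's statements minus the two conjuncts, proofs verbatim.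
HONEST FRAMING: count-neutral helper; a TOKEN-DELETION twin of landed helper files (no landed theorem is wrong: the deleted conjunct is TRUE where the originals are used, it is
merely unavailable for the junction's precomposed gauge function); nothing of [6]∕[15]∕[I] asserted or discharged; `DatumCrownPhiAt` ∕ `HThm4RecSym152PhiE(G)` ∕ `HThm4Rec*`
DISPLAYED∕CONDITIONAL; N05 ∕ N07 NOT discharged; K0⁷ ∕ K1⁹ NOT closed; counts unmoved (typed 28∕28 · discharged 8∕28); one finite 𝕋⁴ programme at fixed ε — R4 closes the conditional
finite-𝕋⁴ rung `BalabanLadder.UV` only; the YM mass gap (Clay) is NOT proved by any of this; nothing continuum ∕ ℝ⁴ ∕ OS.  No `def`, no `instance`, no `notation`, no `sorry`.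

References: [15] (144)–(153) pp. 300–301, (152) p. 301; [6] Prop. 6 (1.135)–(1.138) p. 99, (1.29) p. 81, (1.131) p. 99; [3] = [Balaban1985Averaging] (78)–(81) p. 30; [I] (0.3)–(0.4) pp. 252–253.
-/

noncomputable section

namespace Literature.MathematicalPhysics.QuantumFieldTheory.Balaban1983to89.Node00

open scoped Matrix.Norms.L2Operator
open B7Prop1Explicit (e e_apply gaugeAct)
open B7Prop1Local (InBox AgreeOn)
open B7Prop2Explicit (unitaryUnits mem_unitaryUnits)
open B7Prop2SpecialUnitary (specialUnitaryUnits mem_specialUnitaryUnits)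
open BlockAveragingZd (avgIterZ ctrShift)
open B8Ineq132 (covDerivFwd covDeriv BondTouches)
open B8Eq131Cubes (tLo tHi ctr gs)
open B8Eq131CubesRec (boxZ cubeZ tcubeZ bLoZ bHiZ)
open B8Eq140Level (SideTouches sideTouches_of_bondTouches)
open B8Eq138LandauZd (logCfg covDivB covLap)
open B8Eq138LandauZdRec (IsLandau138Z IsLandau138WZ)
open B7SectEFLinearisationRec (logCovIterZ)
open B8Eq184Proof (cfgExp)
open B8LeafModelZd3 (mlogCfg)
open B8ScaledSupNorm (msup Bdd bondNorm)
open B8Eq146AExpansion (plaqCovDeriv iEta)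
open B8Eq143PlaqExpansion (pdiv)
open MatrixLog (mlog)
open Complex (I)
open B8Eq140Level (SideTouches)
open B15Eq112TorusCover (cover)
open B14DomainGeom (Pt)
open B12RegularSpaces111 (gaugeU expI grad)

section Stage1Precomp

variable {d N : ℕ} [NeZero N] {L K : ℕ} {Ω : ℕ → Set (B7Prop1Explicit.Site d)}

/-- ★★ **STAGE 1 OF THE R7 DOOR, PRE-COMPOSED EDITION** — `exists_suGauge_letters152_recTower_member_grad` (g12) with the pass-through conjuncts `Restr129Z L c.k c.lamS 1 u` and (1.137) `logCovIterZ … = mlog (avgIterZ L (c.axial V) …)` deleted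
from `hG` and from the exported tuple; everything else (the `SU(N)` normalisation on `□₀`, the (152) letters at every level, the Landau row, the member identity `ιSU s = u_m⁻¹·vfix`, the
all-levels gradient letter and the `(−2)` row) VERBATIM, proof verbatim.
[cite: Balaban1985Variational, (152) p.301, (144)–(153) pp.300–301; Balaban1985RegularSpaces, Prop. 6 (1.135)–(1.136) p.99, (1.29) p.81, (1.131) p.99, p.77; Balaban1985Averaging, (78)–(81) p.30; Balaban1987RG1, (0.3)–(0.4) pp.252–253] -/
theorem exists_suGauge_letters152_recTower_member_grad_precomp (hd : 2 ≤ d) (hLo : Odd L) (hL : 2 ≤ L) (c : CubeB8DZ d L K Ω)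
    (V : B7Prop1Explicit.Site d → Fin d → (MatA N)ˣ) (hV : ∀ x μ, V x μ ∈ specialUnitaryUnits (Fin N)) {η r : ℝ} (hη : 0 < η) (hr : 0 ≤ r)
    (hG : letI : CStarAlgebra (MatA N) := {};
      ∃ u : B7Prop1Explicit.Site d → (MatA N)ˣ, (∀ x, u x ∈ specialUnitaryUnits (Fin N)) ∧ (∀ x, x ∉ c.sq 0 → u x = 1) ∧
        IsLandau138WZ L c.k η (c.sq 0) c.lamS (1 : B7Prop1Explicit.Site d → Fin d → (MatA N)ˣ) (c.fixed V u) ∧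
        (∀ j, j ≤ c.k → ∀ b ∈ {b : B7Prop1Explicit.Site d × Fin d | SideTouches (c.sq j) b.1 b.2},
          c.fixed V u b.1 b.2 = cfgExp η (logCfg η (c.fixed V u)) b.1 b.2 ∧ IsSelfAdjoint (logCfg η (c.fixed V u) b.1 b.2) ∧
            ‖logCfg η (c.fixed V u) b.1 b.2‖ ≤ r * ((L : ℝ) ^ j * η)⁻¹) ∧
        (∀ x, ((c.vfix V)⁻¹ * u) x ∈ specialUnitaryUnits (Fin N)) ∧
        AgreeOn (B8Ineq130Rec.tlo L (tLo c.a c.ρ) c.k) (B8Ineq130Rec.thi L (tHi c.a c.M c.ρ) c.k) (gaugeAct ((c.vfix V)⁻¹ * u)⁻¹ V) (c.fixed V u) ∧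
        msup L c.k η (-(2 : ℝ)) (fun j (t : Fin d × Fin d × B7Prop1Explicit.Site d) => SideTouches (c.sq j) t.2.2 t.2.1)
            (fun t => covDerivFwd η (1 : B7Prop1Explicit.Site d → Fin d → (MatA N)ˣ) t.1 (fun z => c.expo η V u z t.2.1) t.2.2) ≤ r ∧
        bondNorm L c.k η (-(3 : ℝ)) c.sq
            (fun x μ => pdiv η (1 : B7Prop1Explicit.Site d → Fin d → (MatA N)ˣ) (plaqCovDeriv η (1 : B7Prop1Explicit.Site d → Fin d → (MatA N)ˣ) (c.expo η V u)) μ x) ≤ r ∧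
        bondNorm L c.k η (-(3 : ℝ)) c.sq (fun x μ => covLap η (1 : B7Prop1Explicit.Site d → Fin d → (MatA N)ˣ) (fun z => c.expo η V u z μ) x) ≤ r)
    (hsmall : 4 * ((N : ℝ) * r) < 2 * Real.pi) :
    letI : CStarAlgebra (MatA N) := {}
    ∃ s : B7Prop1Explicit.Site d → Matrix.specialUnitaryGroup (Fin N) ℂ, ∃ um : B7Prop1Explicit.Site d → (MatA N)ˣ,
      (∀ x μ, x ∈ c.sq 0 → x + e μ ∈ c.sq 0 →
          gaugeAct (fun y => ιSU N (s y)) V x μ = cfgExp η (logCfg η (c.fixed V um)) x μ) ∧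
      (∀ j, j ≤ c.k → ∀ x μ, x ∈ c.sq j → x + e μ ∈ c.sq j → ‖logCfg η (c.fixed V um) x μ‖ ≤ 2 * (r * ((L : ℝ) ^ j * η)⁻¹)) ∧
      (∀ x μ, x ∈ cubeZ L c.a c.M c.ρ c.k c.k → x + e μ ∈ cubeZ L c.a c.M c.ρ c.k c.k →
          ‖logCfg η (c.fixed V um) x μ‖ ≤ 2 * (r * ((L : ℝ) ^ (c.k - 1) * η)⁻¹)) ∧
      (∀ x μ ν, x ∈ cubeZ L c.a c.M c.ρ c.k c.k → x + e μ ∈ cubeZ L c.a c.M c.ρ c.k c.k → x + e ν ∈ cubeZ L c.a c.M c.ρ c.k c.k →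
          ‖logCfg η (c.fixed V um) (x + e μ) ν - logCfg η (c.fixed V um) x ν‖ ≤ 2 * (η * r * (((L : ℝ) ^ (c.k - 1) * η) ^ 2)⁻¹)) ∧
      (∀ x μ, x ∈ cubeZ L c.a c.M c.ρ c.k c.k → x + e μ ∈ cubeZ L c.a c.M c.ρ c.k c.k →
          (∀ ν, x + e ν ∈ cubeZ L c.a c.M c.ρ c.k c.k ∧ x - e ν ∈ cubeZ L c.a c.M c.ρ c.k c.k ∧ x - e ν + e μ ∈ cubeZ L c.a c.M c.ρ c.k c.k) →
          ‖pdiv η (1 : B7Prop1Explicit.Site d → Fin d → (MatA N)ˣ) (plaqCovDeriv η 1 (logCfg η (c.fixed V um))) μ x‖ ≤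
            2 * (r * (((L : ℝ) ^ (c.k - 1) * η) ^ 3)⁻¹)) ∧
      (∀ x μ, x ∈ cubeZ L c.a c.M c.ρ c.k c.k → x + e μ ∈ cubeZ L c.a c.M c.ρ c.k c.k →
          (∀ ν, x + e ν ∈ cubeZ L c.a c.M c.ρ c.k c.k ∧ x - e ν ∈ cubeZ L c.a c.M c.ρ c.k c.k) →
          ‖covLap η (1 : B7Prop1Explicit.Site d → Fin d → (MatA N)ˣ) (fun z => logCfg η (c.fixed V um) z μ) x‖ ≤ 2 * (r * (((L : ℝ) ^ (c.k - 1) * η) ^ 3)⁻¹)) ∧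
      IsLandau138Z L c.k η (c.sq 0) c.lamS (1 : B7Prop1Explicit.Site d → Fin d → (MatA N)ˣ) (logCfg η (c.fixed V um)) ∧
      (∀ x, x ∈ c.sq 0 → ιSU N (s x) = (um x)⁻¹ * c.vfix V x) ∧
      (∀ x, um x ∈ specialUnitaryUnits (Fin N)) ∧ (∀ x, x ∉ c.sq 0 → um x = 1) ∧
      -- ★ NEW (T2b input): (152) member 2 read at EVERY level of the dented tower, for the EXPORTED member gauge `um`
      (∀ j, j ≤ c.k → ∀ x μ ν, x ∈ c.sq j → x + e μ ∈ c.sq j →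
          ‖logCfg η (c.fixed V um) (x + e μ) ν - logCfg η (c.fixed V um) x ν‖ ≤ 2 * (η * r * (((L : ℝ) ^ j * η) ^ 2)⁻¹)) ∧
      -- ★ NEW (pass-through): the crown's `|∇^η A|_(−2) ≤ r` row itself, for `um`
      msup L c.k η (-(2 : ℝ)) (fun j (t : Fin d × Fin d × B7Prop1Explicit.Site d) => SideTouches (c.sq j) t.2.2 t.2.1)
          (fun t => covDerivFwd η (1 : B7Prop1Explicit.Site d → Fin d → (MatA N)ˣ) t.1 (fun z => c.expo η V um z t.2.1) t.2.2) ≤ r := by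
  letI : CStarAlgebra (MatA N) := {}
  have hL1 : 1 ≤ L := le_trans (by norm_num) hL
  have hk1 : c.k - 1 ≤ c.k := Nat.sub_le _ _
  obtain ⟨u, hu, hoff, h138, h162, hw, h135, h136₂, h136₃, h136₄⟩ := hG
  set w : B7Prop1Explicit.Site d → (MatA N)ˣ := (c.vfix V)⁻¹ * u with hwdef
  set U₁ : B7Prop1Explicit.Site d → Fin d → (MatA N)ˣ := c.fixed V u with hU₁
  have h138' : IsLandau138Z L c.k η (c.sq 0) c.lamS (1 : B7Prop1Explicit.Site d → Fin d → (MatA N)ˣ) (logCfg η U₁) := h138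
  have h136' : ∀ j, j ≤ c.k → ∀ b ∈ {b : B7Prop1Explicit.Site d × Fin d | SideTouches (c.sq j) b.1 b.2},
      ‖logCfg η U₁ b.1 b.2‖ ≤ r * ((L : ℝ) ^ j * η)⁻¹ := fun j hj b hb => (h162 j hj b hb).2.2
  -- `□₀` as a centred `InBox`, inside `□̃`
  set lo₀ : B7Prop1Explicit.Site d := bLoZ L c.a c.k (c.ρ * gs L c.k) with hlo₀
  set hi₀ : B7Prop1Explicit.Site d := bHiZ L c.a c.M c.k (c.ρ * gs L c.k) with hhi₀
  have hsq : ∀ x, InBox lo₀ hi₀ x ↔ x ∈ c.sq 0 := fun x => (CubeB8DZ.mem_sq_zero_iff_inBox hLo c x).symm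
  have hsqT : c.sq 0 ⊆ tcubeZ L c.a c.M c.ρ c.k := CubeB8DZ.sq_zero_subset_tcube hLo hL c
  -- the data of the SU normalisation on the box `□₀`: `w⁻¹` is `SU(N)`-valued
  have hg : ∀ x, InBox lo₀ hi₀ x → w⁻¹ x ∈ specialUnitaryUnits (Fin N) := fun x _ => by
    rw [Pi.inv_apply]; exact (specialUnitaryUnits (Fin N)).inv_mem (hw x)
  have hgauge : ∀ x μ, InBox lo₀ hi₀ x → InBox lo₀ hi₀ (x + e μ) → gaugeAct w⁻¹ V x μ = cfgExp η (logCfg η U₁) x μ := by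
    intro x μ hx hx'
    have hx0 := (hsq x).1 hx
    rw [h135 x μ (hsqT hx0) (hsqT ((hsq _).1 hx'))]
    exact (h162 0 (Nat.zero_le _) (x, μ) (sideTouches_of_mem_fam hd hx0 μ)).1
  have hsa : ∀ x μ, InBox lo₀ hi₀ x → InBox lo₀ hi₀ (x + e μ) → IsSelfAdjoint (logCfg η U₁ x μ) := fun x μ hx _ =>
    (h162 0 (Nat.zero_le _) (x, μ) (sideTouches_of_mem_fam hd ((hsq x).1 hx) μ)).2.1
  have hA : ∀ x μ, InBox lo₀ hi₀ x → InBox lo₀ hi₀ (x + e μ) → η * (N * ‖logCfg η U₁ x μ‖) ≤ N * r := by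
    intro x μ hx _
    have h := h136' 0 (Nat.zero_le _) (x, μ) (sideTouches_of_mem_fam hd ((hsq x).1 hx) μ)
    simp only [pow_zero, one_mul] at h
    have hN : (0 : ℝ) ≤ N := Nat.cast_nonneg N
    calc η * (N * ‖logCfg η U₁ x μ‖) ≤ η * (N * (r * η⁻¹)) := mul_le_mul_of_nonneg_left (mul_le_mul_of_nonneg_left h hN) hη.le
      _ = N * r := by field_simp
  have hVdet : ∀ x μ, InBox lo₀ hi₀ x → InBox lo₀ hi₀ (x + e μ) → ((V x μ : (MatA N)ˣ) : MatA N).det = 1 := fun x μ _ _ =>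
    (Matrix.mem_specialUnitaryGroup_iff.1 (hV x μ)).2
  obtain ⟨s, hs, -, hsg⟩ := exists_suGauge_of_specialUnitaryGauge_local lo₀ hi₀ hη V w⁻¹ (logCfg η U₁) hVdet hg hgauge hsa hA hsmall
  -- the pure top cube `□_k` lies in `Ω′_{k−1}`: every bond based in it is a side touching the tower (the window of the unmasked readings)
  have htop : cubeZ L c.a c.M c.ρ c.k c.k ⊆ c.sq (c.k - 1) := CubeB8DZ.cube_top_subset_sq_pred hLo c
  have hW : ∀ y ∈ cubeZ L c.a c.M c.ρ c.k c.k, ∀ τ : Fin d, ∃ j, j ≤ c.k ∧ SideTouches (c.sq j) y τ :=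
    fun y hy τ => ⟨c.k - 1, hk1, sideTouches_of_mem_fam hd (htop hy) τ⟩
  -- weakening `t ≤ 2t` for the nonnegative letters
  have h2 : ∀ {a t : ℝ}, 0 ≤ t → a ≤ t → a ≤ 2 * t := fun ht h => h.trans (by linarith)
  have hLη : ∀ j : ℕ, 0 ≤ r * ((L : ℝ) ^ j * η)⁻¹ := fun j => by positivity
  refine ⟨s, u, fun x μ hx hx' => hsg x μ ((hsq x).2 hx) ((hsq _).2 hx'), fun j hj x μ hx _ => ?_, fun x μ hx _ => ?_, fun x μ ν hx hx' _ => ?_,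
    fun x μ hx hx' hν => ?_, fun x μ hx _ hν => ?_, h138', fun x hx => ?_, hu, hoff, fun j hj x μ ν hx hx' => ?_, h136₂⟩
  · exact h2 (hLη j) (h136' j hj (x, μ) (sideTouches_of_mem_fam hd hx μ))
  · exact h2 (hLη (c.k - 1)) (h136' (c.k - 1) hk1 (x, μ) (sideTouches_of_mem_fam hd (htop hx) μ))
  · exact h2 (by positivity) (norm_logCfg_sub_le_of_msup_grad_at c.sq c.k hL1 hη hr U₁ h136' h136₂ hW hk1 hx hx'
      (sideTouches_of_mem_fam hd (htop hx) ν))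
  · exact h2 (by positivity) (norm_codiff_logCfg_le_at c.sq c.k hL1 hη hr U₁ h136' h136₃ hW hk1 hx hx' hν (Or.inl (htop hx)))
  · exact h2 (by positivity) (norm_lap_logCfg_le_at c.sq c.k hL1 hη hr U₁ h136' h136₄ hW hk1 hx (fun ν => ⟨(hν ν).1, (hν ν).2⟩) (Or.inl (htop hx)))
  · rw [hs x ((hsq x).2 hx), hwdef]
    simp only [Pi.inv_apply, Pi.mul_apply, mul_inv_rev, inv_inv]
  · -- the new all-levels gradient letter: window `W := Ω′₀` (every site of `Ω′₀` is a side of a plaquette touching `Ω′₀`), level `j`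
    have hW0 : ∀ y ∈ c.sq 0, ∀ τ : Fin d, ∃ j', j' ≤ c.k ∧ SideTouches (c.sq j') y τ :=
      fun y hy τ => ⟨0, Nat.zero_le _, sideTouches_of_mem_fam hd hy τ⟩
    have hsub : c.sq j ⊆ c.sq 0 := B8Eq191FlatLettersDentedCubeMemberRec.sq_antitone c hLo (Nat.zero_le j)
    exact h2 (by positivity) (norm_logCfg_sub_le_of_msup_grad_at c.sq c.k hL1 hη hr U₁ h136' h136₂ hW0 hj (hsub hx) (hsub hx')
      (sideTouches_of_mem_fam hd hx ν))

end Stage1Precomp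

section Stage2Precomp

variable {P : Params} {N : ℕ} [NeZero N]

/-- ★★ **STAGE 2 OF THE R7 DOOR, PRE-COMPOSED EDITION** — `exists_localGauge152_recTower_window_member_grad` (g12: the window push-down through the translated cover
`x ↦ π(x + t)`, injective on the large window `X′`) with the pass-through conjuncts `Restr129Z P.L c.k c.lamS 1 u` and (1.137) `logCovIterZ … = mlog (avgIterZ P.L (c.axial V) …)` deleted from `hG` and from the exported tuple;
proof verbatim over STAGE 1's pre-composed edition.
[cite: Balaban1985Variational, (144)–(153) pp.300–301; Balaban1985RegularSpaces, Prop. 6 (1.135)–(1.138) p.99, (1.29) p.81, (1.131) p.99; Balaban1985Averaging, (78)–(81) p.30; Balaban1987RG1, (0.3)–(0.4) pp.252–253] -/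
theorem exists_localGauge152_recTower_window_member_grad_precomp (hd : 2 ≤ P.d) {K' : ℕ} {Ω' : ℕ → Set (B7Prop1Explicit.Site P.d)} (c : CubeB8DZ P.d P.L K' Ω')
    (U : GaugeField P 0 (SU N)) (t : Pt P.d) {n : ℕ} (hk : c.k = n) {r : ℝ} (hr : 0 ≤ r)
    (hG : letI : CStarAlgebra (MatA N) := {};
      ∃ u : B7Prop1Explicit.Site P.d → (MatA N)ˣ, (∀ x, u x ∈ specialUnitaryUnits (Fin N)) ∧ (∀ x, x ∉ c.sq 0 → u x = 1) ∧
        IsLandau138WZ P.L c.k (P.eta n) (c.sq 0) c.lamS (1 : B7Prop1Explicit.Site P.d → Fin P.d → (MatA N)ˣ)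
          (c.fixed (fun x μ => ιSU N (U ⟨cover P (x + t), μ⟩)) u) ∧
        (∀ j, j ≤ c.k → ∀ b ∈ {b : B7Prop1Explicit.Site P.d × Fin P.d | SideTouches (c.sq j) b.1 b.2},
          c.fixed (fun x μ => ιSU N (U ⟨cover P (x + t), μ⟩)) u b.1 b.2 =
              cfgExp (P.eta n) (logCfg (P.eta n) (c.fixed (fun x μ => ιSU N (U ⟨cover P (x + t), μ⟩)) u)) b.1 b.2 ∧
            IsSelfAdjoint (logCfg (P.eta n) (c.fixed (fun x μ => ιSU N (U ⟨cover P (x + t), μ⟩)) u) b.1 b.2) ∧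
            ‖logCfg (P.eta n) (c.fixed (fun x μ => ιSU N (U ⟨cover P (x + t), μ⟩)) u) b.1 b.2‖ ≤ r * ((P.L : ℝ) ^ j * P.eta n)⁻¹) ∧
        (∀ x, ((c.vfix (fun x μ => ιSU N (U ⟨cover P (x + t), μ⟩)))⁻¹ * u) x ∈ specialUnitaryUnits (Fin N)) ∧
        AgreeOn (B8Ineq130Rec.tlo P.L (tLo c.a c.ρ) c.k) (B8Ineq130Rec.thi P.L (tHi c.a c.M c.ρ) c.k)
          (gaugeAct ((c.vfix (fun x μ => ιSU N (U ⟨cover P (x + t), μ⟩)))⁻¹ * u)⁻¹ (fun x μ => ιSU N (U ⟨cover P (x + t), μ⟩)))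
          (c.fixed (fun x μ => ιSU N (U ⟨cover P (x + t), μ⟩)) u) ∧
        msup P.L c.k (P.eta n) (-(2 : ℝ)) (fun j (q : Fin P.d × Fin P.d × B7Prop1Explicit.Site P.d) => SideTouches (c.sq j) q.2.2 q.2.1)
            (fun q => covDerivFwd (P.eta n) (1 : B7Prop1Explicit.Site P.d → Fin P.d → (MatA N)ˣ) q.1
              (fun z => c.expo (P.eta n) (fun x μ => ιSU N (U ⟨cover P (x + t), μ⟩)) u z q.2.1) q.2.2) ≤ r ∧
        bondNorm P.L c.k (P.eta n) (-(3 : ℝ)) c.sq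
            (fun x μ => pdiv (P.eta n) (1 : B7Prop1Explicit.Site P.d → Fin P.d → (MatA N)ˣ)
              (plaqCovDeriv (P.eta n) (1 : B7Prop1Explicit.Site P.d → Fin P.d → (MatA N)ˣ)
                (c.expo (P.eta n) (fun x μ => ιSU N (U ⟨cover P (x + t), μ⟩)) u)) μ x) ≤ r ∧
        bondNorm P.L c.k (P.eta n) (-(3 : ℝ)) c.sq
            (fun x μ => covLap (P.eta n) (1 : B7Prop1Explicit.Site P.d → Fin P.d → (MatA N)ˣ)
              (fun z => c.expo (P.eta n) (fun x μ => ιSU N (U ⟨cover P (x + t), μ⟩)) u z μ) x) ≤ r)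
    {X Xt X' : Set (Pt P.d)} (hXX' : X ⊆ X') (hXt : Xt ⊆ X) (hsq0X' : c.sq 0 ⊆ X') (hinj' : Set.InjOn (fun x => cover P (x + t)) X')
    (hfwd : ∀ ⦃x⦄, x ∈ X → ∀ μ, (cover P (x + t)).shift μ ∈ (fun x => cover P (x + t)) '' X → x + e μ ∈ X)
    (hfwdt : ∀ ⦃x⦄, x ∈ Xt → ∀ μ, (cover P (x + t)).shift μ ∈ (fun x => cover P (x + t)) '' Xt → x + e μ ∈ Xt)
    (hbwdt : ∀ ⦃x⦄, x ∈ Xt → ∀ ν, (cover P (x + t)).unshift ν ∈ (fun x => cover P (x + t)) '' Xt → x - e ν ∈ Xt)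
    (hsq : X ⊆ c.sq 0) (hbox : Xt ⊆ cubeZ P.L c.a c.M c.ρ c.k c.k)
    (h4 : 4 * ((N : ℝ) * r) < 2 * Real.pi) :
    letI : CStarAlgebra (MatA N) := {}
    ∃ u : GaugeTransf P 0 (SU N), ∃ A : PBond P 0 → MatA N, ∃ um : B7Prop1Explicit.Site P.d → (MatA N)ˣ,
      (∀ b ∈ (Sect2.regionOfSet P ((fun x => cover P (x + t)) '' X)).bonds, gaugeU (fun x => ιSU N (u x)) (fun b' => ιSU N (U b')) b = expI (P.eta n) (A b)) ∧
      (∀ j, j ≤ c.k → ∀ (x : Pt P.d) (μ : Fin P.d), x ∈ X → x + e μ ∈ X → x ∈ c.sq j → x + e μ ∈ c.sq j →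
          ‖A ⟨cover P (x + t), μ⟩‖ ≤ 2 * (r * ((P.L : ℝ) ^ j * P.eta n)⁻¹)) ∧
      (∀ b ∈ (Sect2.regionOfSet P ((fun x => cover P (x + t)) '' Xt)).bonds, ‖A b‖ ≤ 2 * (r * P.L)) ∧
      (∀ q ∈ (Sect2.regionOfSet P ((fun x => cover P (x + t)) '' Xt)).dpairs, ‖grad (P.eta n) q.2.1 (fun y => A ⟨y, q.2.2⟩) q.1‖ ≤ 2 * (r * (P.L : ℝ) ^ 2)) ∧
      (∀ b ∈ Sect2.bondsDeep ((fun x => cover P (x + t)) '' Xt), ‖Sect2.codiffCurlA (P.eta n) A b.src b.dir‖ ≤ 2 * (r * (P.L : ℝ) ^ 3)) ∧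
      (∀ b ∈ Sect2.bondsDeep ((fun x => cover P (x + t)) '' Xt),
          ‖∑ ν : Fin P.d, ((P.eta n : ℝ) : ℂ)⁻¹ •
              (grad (P.eta n) ν (fun y => A ⟨y, b.dir⟩) (b.src.unshift ν) - grad (P.eta n) ν (fun y => A ⟨y, b.dir⟩) b.src)‖ ≤ 2 * (r * (P.L : ℝ) ^ 3)) ∧
      (∀ x, x ∈ X' → ∀ μ, A ⟨cover P (x + t), μ⟩ = logCfg (P.eta n) (c.fixed (fun x μ => ιSU N (U ⟨cover P (x + t), μ⟩)) um) x μ) ∧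
      IsLandau138Z P.L c.k (P.eta n) (c.sq 0) c.lamS (1 : B7Prop1Explicit.Site P.d → Fin P.d → (MatA N)ˣ)
        (logCfg (P.eta n) (c.fixed (fun x μ => ιSU N (U ⟨cover P (x + t), μ⟩)) um)) ∧
      (∀ x, x ∈ c.sq 0 → ιSU N (u (cover P (x + t))) = (um x)⁻¹ * c.vfix (fun x μ => ιSU N (U ⟨cover P (x + t), μ⟩)) x) ∧
      (∀ x, um x ∈ specialUnitaryUnits (Fin N)) ∧ (∀ x, x ∉ c.sq 0 → um x = 1) ∧
      -- ★ NEW (T2b input, ℤᵈ side, passed through): (152) member 2 at EVERY level for the exported `um`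
      (∀ j, j ≤ c.k → ∀ (x : B7Prop1Explicit.Site P.d) (μ ν : Fin P.d), x ∈ c.sq j → x + e μ ∈ c.sq j →
          ‖logCfg (P.eta n) (c.fixed (fun x μ => ιSU N (U ⟨cover P (x + t), μ⟩)) um) (x + e μ) ν
              - logCfg (P.eta n) (c.fixed (fun x μ => ιSU N (U ⟨cover P (x + t), μ⟩)) um) x ν‖ ≤
            2 * (P.eta n * r * (((P.L : ℝ) ^ j * P.eta n) ^ 2)⁻¹)) ∧
      -- ★ NEW (pass-through): the crown's `(−2)` row for `um`
      msup P.L c.k (P.eta n) (-(2 : ℝ)) (fun j (q : Fin P.d × Fin P.d × B7Prop1Explicit.Site P.d) => SideTouches (c.sq j) q.2.2 q.2.1)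
          (fun q => covDerivFwd (P.eta n) (1 : B7Prop1Explicit.Site P.d → Fin P.d → (MatA N)ˣ) q.1
            (fun z => c.expo (P.eta n) (fun x μ => ιSU N (U ⟨cover P (x + t), μ⟩)) um z q.2.1) q.2.2) ≤ r := by
  classical
  letI : CStarAlgebra (MatA N) := {}
  have hLo : Odd P.L := P.hL.1
  have hL : 2 ≤ P.L := P.hL.2
  have hηpos : 0 < P.eta n := B3GkZeroTorusRescaled.eta_pos P n
  set V : B7Prop1Explicit.Site P.d → Fin P.d → (MatA N)ˣ := fun x μ => ιSU N (U ⟨cover P (x + t), μ⟩) with hV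
  have hVsu : ∀ x μ, V x μ ∈ specialUnitaryUnits (Fin N) := fun x μ => by
    rw [hV]; exact mem_specialUnitaryUnits.2 (U ⟨cover P (x + t), μ⟩).2
  obtain ⟨s, um, h1, hlev, h2, h3, h4c, h4', h5, hsid, hsu, hoff, hgradAll, hmsup⟩ :=
    exists_suGauge_letters152_recTower_member_grad_precomp hd hLo hL c V hVsu hηpos hr hG h4
  -- the scale of the dent's level: `L^{k−1}·η_n = L⁻¹`, `Lᵏ·η_n = 1`
  have hscale : (P.L : ℝ) ^ c.k * P.eta n = 1 := by rw [hk]; exact B12Eq115BackgroundPair.pow_mul_eta P n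
  have hLpos : (0 : ℝ) < P.L := by exact_mod_cast P.L_pos
  have hscale' : (P.L : ℝ) ^ (c.k - 1) * P.eta n = (P.L : ℝ)⁻¹ := by
    have hk1 : c.k - 1 + 1 = c.k := Nat.sub_add_cancel c.one_le_k
    have h : (P.L : ℝ) ^ c.k = (P.L : ℝ) ^ (c.k - 1) * P.L := by rw [← pow_succ, hk1]
    have h' : (P.L : ℝ) ^ (c.k - 1) * P.eta n * P.L = 1 := by rw [mul_right_comm, ← h, hscale]
    exact eq_inv_of_mul_eq_one_left h'
  simp only [hscale', inv_inv, inv_pow] at h2 h3 h4c h4'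
  set A' : B7Prop1Explicit.Site P.d → Fin P.d → MatA N := logCfg (P.eta n) (c.fixed V um) with hA'
  have hinjt : Set.InjOn (fun x => cover P (x + t)) Xt := hinj'.mono (hXt.trans hXX')
  -- push-down through the translated cover, injective on the LARGE window `X′`
  let u : GaugeTransf P 0 (SU N) := fun y =>
    if h : ∃ x, x ∈ X' ∧ cover P (x + t) = y then s (Classical.choose h) else 1
  let A : PBond P 0 → MatA N := fun b =>
    if h : ∃ x, x ∈ X' ∧ cover P (x + t) = b.src then A' (Classical.choose h) b.dir else 0
  have hu : ∀ x, x ∈ X' → u (cover P (x + t)) = s x := by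
    intro x hx
    have hex : ∃ x', x' ∈ X' ∧ cover P (x' + t) = cover P (x + t) := ⟨x, hx, rfl⟩
    simp only [u, dif_pos hex]
    rw [hinj' (Classical.choose_spec hex).1 hx (Classical.choose_spec hex).2]
  have hA : ∀ x, x ∈ X' → ∀ μ, A ⟨cover P (x + t), μ⟩ = A' x μ := by
    intro x hx μ
    have hex : ∃ x', x' ∈ X' ∧ cover P (x' + t) = cover P (x + t) := ⟨x, hx, rfl⟩
    simp only [A, dif_pos hex]
    rw [hinj' (Classical.choose_spec hex).1 hx (Classical.choose_spec hex).2]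
  have hlift : ∀ y, y ∈ (fun x => cover P (x + t)) '' X → ∃ x, x ∈ X ∧ cover P (x + t) = y := fun y ⟨x, hx, hxy⟩ => ⟨x, hx, hxy⟩
  have hliftt : ∀ y, y ∈ (fun x => cover P (x + t)) '' Xt → ∃ x, x ∈ Xt ∧ cover P (x + t) = y := fun y ⟨x, hx, hxy⟩ => ⟨x, hx, hxy⟩
  have hXtX' : Xt ⊆ X' := hXt.trans hXX'
  have hL1 : (1 : ℝ) ≤ P.L := by exact_mod_cast P.L_pos
  refine ⟨u, A, um, fun b hb => ?_, fun j hj x μ hx hx' hxj hxj' => ?_, fun b hb => ?_, fun q hq => ?_, fun b hb => ?_, fun b hb => ?_, hA, h5,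
    fun x hx => ?_, hsu, hoff, hgradAll, hmsup⟩
  · obtain ⟨x, hx, hxs⟩ := hlift b.src hb.1
    have hx' : x + e b.dir ∈ X := hfwd hx b.dir (by rw [hxs]; exact hb.2)
    have hb' : b = ⟨cover P (x + t), b.dir⟩ := by cases b; simp only at hxs; rw [hxs]
    rw [hb', hA x (hXX' hx)]
    have hgauge := h1 x b.dir (hsq hx) (hsq hx')
    rw [cfgExp_eq_expI] at hgauge
    rw [← hgauge]
    simp only [gaugeU, B7Prop1Explicit.gaugeAct, PBond.tgt, ← cover_shift_add_e, hu x (hXX' hx), hu (x + e b.dir) (hXX' hx'), hV]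
  · rw [hA x (hXX' hx)]
    exact hlev j hj x μ hxj hxj'
  · obtain ⟨x, hx, hxs⟩ := hliftt b.src hb.1
    have hx' : x + e b.dir ∈ Xt := hfwdt hx b.dir (by rw [hxs]; exact hb.2)
    have hb' : b = ⟨cover P (x + t), b.dir⟩ := by cases b; simp only at hxs; rw [hxs]
    rw [hb', hA x (hXtX' hx)]
    exact h2 x b.dir (hbox hx) (hbox hx')
  · obtain ⟨hq1, hq2, hq3, -⟩ := hq
    obtain ⟨x, hx, hxs⟩ := hliftt q.1 hq1
    have hxμ : x + e q.2.1 ∈ Xt := hfwdt hx q.2.1 (by rw [hxs]; exact hq2)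
    have hxν : x + e q.2.2 ∈ Xt := hfwdt hx q.2.2 (by rw [hxs]; exact hq3)
    rw [grad, ← hxs, ← cover_shift_add_e, hA x (hXtX' hx), hA (x + e q.2.1) (hXtX' hxμ), norm_smul, norm_inv, Complex.norm_real, Real.norm_eq_abs,
      abs_of_pos hηpos]
    calc (P.eta n)⁻¹ * ‖A' (x + e q.2.1) q.2.2 - A' x q.2.2‖ ≤ (P.eta n)⁻¹ * (2 * (P.eta n * r * (P.L : ℝ) ^ 2)) :=
          mul_le_mul_of_nonneg_left (h3 x q.2.1 q.2.2 (hbox hx) (hbox hxμ) (hbox hxν)) (inv_nonneg.2 hηpos.le)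
      _ = 2 * (r * (P.L : ℝ) ^ 2) := by field_simp
  · obtain ⟨hb1, hb2, hbν⟩ := hb
    obtain ⟨x, hx, hxs⟩ := hliftt b.src hb1
    have hxμ : x + e b.dir ∈ Xt := hfwdt hx b.dir (by rw [hxs]; exact hb2)
    have hstencil : ∀ ν, x + e ν ∈ Xt ∧ x - e ν ∈ Xt ∧ x - e ν + e b.dir ∈ Xt := by
      intro ν
      obtain ⟨s1, s2, s3, s4⟩ := hbν ν
      have hxν : x + e ν ∈ Xt := hfwdt hx ν (by rw [hxs]; exact s1)
      have hxν' : x - e ν ∈ Xt := hbwdt hx ν (by rw [hxs]; exact s2)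
      have hxν'' : x - e ν + e b.dir ∈ Xt :=
        hfwdt hxν' b.dir (by
          rw [cover_shift_sub_e, hxs, ← Site.unshift_shift_comm]
          exact s4)
      exact ⟨hxν, hxν', hxν''⟩
    have hb' : b = ⟨cover P (x + t), b.dir⟩ := by cases b; simp only at hxs; rw [hxs]
    rw [hb']
    show ‖Sect2.codiffCurlA (P.eta n) A (cover P (x + t)) b.dir‖ ≤ 2 * (r * (P.L : ℝ) ^ 3)
    have hAX : ∀ z, z ∈ Xt → ∀ κ, A ⟨cover P (z + t), κ⟩ = A' z κ := fun z hz => hA z (hXtX' hz)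
    rw [codiffCurlA_coverShift_eq_pdiv_of_window (P.eta n) t hAX hx hxμ hstencil]
    exact h4c x b.dir (hbox hx) (hbox hxμ) fun ν => ⟨hbox (hstencil ν).1, hbox (hstencil ν).2.1, hbox (hstencil ν).2.2⟩
  · obtain ⟨hb1, hb2, hbν⟩ := hb
    obtain ⟨x, hx, hxs⟩ := hliftt b.src hb1
    have hxμ : x + e b.dir ∈ Xt := hfwdt hx b.dir (by rw [hxs]; exact hb2)
    have hstencil : ∀ ν, x + e ν ∈ Xt ∧ x - e ν ∈ Xt := by
      intro ν
      obtain ⟨s1, s2, -, -⟩ := hbν ν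
      exact ⟨hfwdt hx ν (by rw [hxs]; exact s1), hbwdt hx ν (by rw [hxs]; exact s2)⟩
    have hb' : b = ⟨cover P (x + t), b.dir⟩ := by cases b; simp only at hxs; rw [hxs]
    rw [hb']
    show ‖∑ ν : Fin P.d, ((P.eta n : ℝ) : ℂ)⁻¹ •
        (grad (P.eta n) ν (fun y => A ⟨y, b.dir⟩) ((cover P (x + t)).unshift ν) - grad (P.eta n) ν (fun y => A ⟨y, b.dir⟩) (cover P (x + t)))‖ ≤
          2 * (r * (P.L : ℝ) ^ 3)
    have hAX : ∀ z, z ∈ Xt → ∀ κ, A ⟨cover P (z + t), κ⟩ = A' z κ := fun z hz => hA z (hXtX' hz)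
    rw [lap_coverShift_eq_covLap_of_window (P.eta n) t hAX hx hstencil]
    exact h4' x b.dir (hbox hx) (hbox hxμ) fun ν => ⟨hbox (hstencil ν).1, hbox (hstencil ν).2⟩
  · rw [hu x (hsq0X' hx)]
    exact hsid x hx

end Stage2Precomp

end Literature.MathematicalPhysics.QuantumFieldTheory.Balaban1983to89.Node00

end
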